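import Literature.NumberTheory.EllipticCurves.NeronComponentIndexTypeIVProofs
import Literature.NumberTheory.EllipticCurves.NeronComponentIndexTypeIVstarProofs
import Literature.NumberTheory.EllipticCurves.NeronComponentIndexProofs
import Literature.NumberTheory.EllipticCurves.OggFormulaTypeIIIProofs
import Literature.NumberTheory.DiophantineGeometry.ConductorExponentLeEightProofs
import Literature.NumberTheory.DiophantineGeometry.TateAlgorithmOggBound
import HarnessLib

/-!
# Ogg's formula at `p = 3`, the wild Kodaira types `II, IV, IV*, II*`: the discriminant side
# (shapes of `b₂, b₄, b₆, Δ` on a `K_v`-model, and `δ_v = ord_v(Δ_min) - m_v - 1`)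

`Proofs` file (theorems only, no definitions, no named facts, no instances) in topic
`NumberTheory/EllipticCurves`, landed by the tenured seat of bsd.S15
(`Literature.NumberTheory.EllipticCurves.conductorNorm_eq_artinConductorNat`).  After
`OggFormulaTypeIstarProofs`, `OggFormulaTypeIIIProofs` (this seat) and
`HasseWeilAbelianConductorSwanIndependenceProofs`, the open content of the `p = 3` half hW3 of
`WeierstrassCurve.swanConductorAt_rationalTate_eq_wildConductorExponent_of_ringChar_eq` is Ogg's
formula for the **`2`-adic** Tate module (equivalently for `E[2]`) at the additive places `v ∣ 3`
of the four *wild* Kodaira types `II, IV, IV*, II*`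
(`swanConductorAt_rationalTate_eq_wildConductorExponent_of_ringChar_eq_three_of_wildTypes`).
Silverman proves it (*ATAEC* IV.11.1, PDF pp. 368–371) from two inputs per type: the Galois side
— the break of the `2`-division field `K(E[2])`, read off the valuations of the roots of the
`2`-division cubic (`CubicEisensteinRamification*Proofs`, `RamificationBreakUniformizerProofs`,
`TwoDivisionRootValuationProofs`) — and the **discriminant side**, which this file supplies from
Tate's algorithm (*ATAEC* IV.9.4) at a place `v ∤ 2` (so `2 ∈ 𝒪_v^×`, perfect residue field):

* `LocalIndex.exists_smul_b_of_kodairaSymbolOfMinimal_eq_II / _IV / _IVstar / _IIstar` — over a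
  discrete valuation ring with `2` a unit, a minimal equation of type `II`, `IV`, `IV*`, `II*` has
  an `R`-model with **`b₂ ∈ 𝔪^{k₂}`, `b₄ ∈ 𝔪^{k₄}`, `b₆ = π^{k₆}·(unit)`** for
  `(k₂, k₄, k₆) = (1,1,1), (1,2,2), (2,3,4), (2,4,5)`: the normal forms of Steps 3, 5, 8, 10
  (`kodairaSymbolOfMinimal_eq_II_imp`, `exists_smul_of_kodairaSymbolOfMinimal_eq_IV`, `_IVstar`,
  `_IIstar` of `NeronComponentIndex*Proofs`) and `b₆ = a₃² + 4a₆` with `4 ∈ R^×`; for `IV*` the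
  Step-8 condition "`Y² + a₃,₂Y - a₆,₄` has distinct roots" is `ā₃,₂² + 4ā₆,₄ ≠ 0`, i.e.
  `b₆/π⁴ ∈ R^×`.  So the `2`-division cubic `x³ + (b₂/4)x² + (b₄/2)x + b₆/4` of the model has
  `ord(A₆) = 1, 2, 4, 5` and `ord(A₂) ≥ 1, 1, 2, 2`, `ord(A₄) ≥ 1, 2, 3, 4` — the hypotheses of
  `val_pow_three_eq_of_root_cubic` giving `ord(α) = 1/3, 2/3, 4/3, 5/3` for its roots
  (*ATAEC* p. 369: "`v_M(α) = 2/3`");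
* `WeierstrassCurve.exists_variableChange_b_of_kodairaSymbolAt_wild` — the same shapes on a
  `K_v`-model `C • E` of an elliptic curve over the fraction field of a Dedekind domain at a place
  `v ∤ 2` of wild type, **with `Δ(C • E) = π^{ord_v(Δ_min)}·(unit)`**;
* `WeierstrassCurve.wildConductorExponent_eq_of_kodairaSymbolAt_eq_II / _IV / _IVstar / _IIstar`
  — the discriminant side proper: **`δ_v = ord_v(Δ_min) - 2, - 4, - 8, - 10`** respectively
  (`f_v = ord_v(Δ_min) + 1 - m_v`, the tree's definition of `conductorExponent` by Ogg's formula,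
  `m_v = 1, 3, 7, 9`, `ε_v = 2`).

## References

* [SilvermanATAEC1994] J. H. Silverman, *Advanced Topics in the Arithmetic of Elliptic Curves*,
  GTM 151, §IV.9 (Tate's algorithm 9.4, Steps 3, 5, 8, 10; Table 4.1) and proof of Thm. IV.11.1
  for `p = 3` (PDF pp. 368–371: "`v(𝔇_{E/K}) = 2 + δ(E/K)` for types II and II\*,
  `= 4 + δ(E/K)` for IV and IV\*").

## Design

Pure theorems; `namespace Literature.NumberTheory.EllipticCurves.LocalIndex` (DVR level) and
`namespace WeierstrassCurve` (places of Dedekind domains).  Axioms: `propext`, `Classical.choice`,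
`Quot.sound`.
-/

noncomputable section

open scoped Classical Polynomial
open IsLocalRing IsDedekindDomain Polynomial
open IsDiscreteValuationRing hiding maximalIdeal

namespace Literature.NumberTheory.EllipticCurves

namespace LocalIndex

open Literature.NumberTheory.DiophantineGeometry Literature.NumberTheory.DiophantineGeometry.TateAlgorithm

variable {R : Type*} [CommRing R] [IsDomain R] [IsDiscreteValuationRing R]

/-! ## §1. The shapes of `b₂, b₄, b₆` over a discrete valuation ring with `2 ∈ R^×` -/

/-- In a DVR: `x ∈ 𝔪ᵏ`, `x ∉ 𝔪ᵏ⁺¹` give `x = πᵏ·u` with `u` a unit (`π = uniformizer R`).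
[folklore] -/
theorem exists_eq_uniformizer_pow_mul_unit {x : R} {k : ℕ} (hx : x ∈ maximalIdeal R ^ k)
    (hx' : x ∉ maximalIdeal R ^ (k + 1)) : ∃ u : R, IsUnit u ∧ x = uniformizer R ^ k * u := by
  have hϖ : Irreducible (uniformizer R) := irreducible_uniformizer
  obtain ⟨u, hu⟩ := (mem_maximalIdeal_pow_iff_dvd_of_irreducible hϖ _ _).mp hx
  refine ⟨u, ?_, hu⟩
  by_contra hunit
  apply hx'
  rw [mem_maximalIdeal_pow_iff_dvd_of_irreducible hϖ, hu, pow_succ]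
  refine mul_dvd_mul_left _ (Ideal.mem_span_singleton.mp ?_)
  rw [← hϖ.maximalIdeal_eq]
  exact (mem_maximalIdeal _).mpr (mem_nonunits_iff.mpr hunit)

/-- `b₆ = a₃² + 4a₆ = πᵏ·(unit)` when `a₃² ∈ 𝔪ᵏ⁺¹`, `a₆ ∈ 𝔪ᵏ ∖ 𝔪ᵏ⁺¹` and `2 ∈ R^×`. [folklore] -/
theorem exists_b₆_eq_of_a₆ (h2 : IsUnit (2 : R)) (V : WeierstrassCurve R) {k : ℕ}
    (h3 : V.a₃ * V.a₃ ∈ maximalIdeal R ^ (k + 1)) (h6 : V.a₆ ∈ maximalIdeal R ^ k)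
    (h6' : V.a₆ ∉ maximalIdeal R ^ (k + 1)) :
    ∃ u : R, IsUnit u ∧ V.b₆ = uniformizer R ^ k * u := by
  have eq : V.b₆ = V.a₃ * V.a₃ + 4 * V.a₆ := by rw [WeierstrassCurve.b₆]; ring
  refine exists_eq_uniformizer_pow_mul_unit ?_ ?_
  · rw [eq]
    exact add_mem (Ideal.pow_le_pow_right (Nat.le_succ k) h3) (Ideal.mul_mem_left _ _ h6)
  · rw [eq]
    intro h
    apply h6'
    have h4 : 4 * V.a₆ ∈ maximalIdeal R ^ (k + 1) := by
      have := Ideal.sub_mem _ h h3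
      rwa [add_sub_cancel_left] at this
    have h4u : IsUnit (4 : R) := by rw [show (4 : R) = 2 * 2 by norm_num]; exact h2.mul h2
    obtain ⟨w, hw⟩ := h4u
    have : V.a₆ = (↑w⁻¹ : R) * (4 * V.a₆) := by rw [← hw, ← mul_assoc, Units.inv_mul, one_mul]
    rw [this]
    exact Ideal.mul_mem_left _ _ h4

/-- **Type `II`, `2 ∈ R^×`: `b₂ ∈ 𝔪`, `b₄ ∈ 𝔪`, `b₆ = π·(unit)`** on the Step-2 model
(`π ∣ a₃, a₄, a₆`, `π ∣ b₂`, `π² ∤ a₆`: *ATAEC* IV.9.4 Step 3).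
[cite: SilvermanATAEC1994, IV.9.4 Step 3] -/
theorem exists_smul_b_of_kodairaSymbolOfMinimal_eq_II [PerfectField (ResidueField R)]
    (h2 : IsUnit (2 : R)) (V : WeierstrassCurve R) (hV : V.kodairaSymbolOfMinimal = .II) :
    ∃ D : WeierstrassCurve.VariableChange R,
      (D • V).b₂ ∈ maximalIdeal R ^ 1 ∧ (D • V).b₄ ∈ maximalIdeal R ^ 1 ∧
      ∃ u : R, IsUnit u ∧ (D • V).b₆ = uniformizer R ^ 1 * u := by
  obtain ⟨hΔ, hb₂, ha₆⟩ := kodairaSymbolOfMinimal_eq_II_imp V hV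
  have hex2 := exists_variableChange_step2_of_perfectField V hΔ
  have hN2 : normalizeStep2 V = hex2.choose • V := dif_pos hex2
  obtain ⟨-, hA₃, hA₄, hA₆⟩ := hex2.choose_spec
  rw [hN2] at hb₂ ha₆
  set N := hex2.choose • V with hN
  have hA₁' : N.a₁ ∈ maximalIdeal R ^ 0 := by rw [pow_zero, Ideal.one_eq_top]; trivial
  have hA₃' : N.a₃ ∈ maximalIdeal R ^ 1 := by rwa [pow_one]
  have hA₄' : N.a₄ ∈ maximalIdeal R ^ 1 := by rwa [pow_one]
  have hA₆' : N.a₆ ∈ maximalIdeal R ^ 1 := by rwa [pow_one]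
  have hb₂' : N.b₂ ∈ maximalIdeal R ^ 1 := by rwa [pow_one]
  refine ⟨hex2.choose, hb₂', OggBound.b₄_mem_pow N (n₁ := 0) (n₃ := 1) (n₄ := 1) hA₁' hA₃' hA₄',
    ?_⟩
  refine exists_b₆_eq_of_a₆ h2 N (k := 1) ?_ hA₆' ha₆
  have := Ideal.mul_mem_mul hA₃' hA₃'
  rwa [← pow_add] at this

/-- **Type `IV`, `2 ∈ R^×`: `b₂ ∈ 𝔪`, `b₄ ∈ 𝔪²`, `b₆ = π²·(unit)`** (normal form of Step 5:
`π ∣ a₁, a₂, a₃`, `π² ∣ a₄, a₆`, `π³ ∤ b₆`). [cite: SilvermanATAEC1994, IV.9.4 Step 5] -/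
theorem exists_smul_b_of_kodairaSymbolOfMinimal_eq_IV [PerfectField (ResidueField R)]
    (V : WeierstrassCurve R) (hV : V.kodairaSymbolOfMinimal = .IV) :
    ∃ D : WeierstrassCurve.VariableChange R,
      (D • V).b₂ ∈ maximalIdeal R ^ 1 ∧ (D • V).b₄ ∈ maximalIdeal R ^ 2 ∧
      ∃ u : R, IsUnit u ∧ (D • V).b₆ = uniformizer R ^ 2 * u := by
  obtain ⟨D, h1, h2', h3, h4, h6, hb₆⟩ := exists_smul_of_kodairaSymbolOfMinimal_eq_IV V hV
  have h1' : (D • V).a₁ ∈ maximalIdeal R ^ 1 := by rwa [pow_one]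
  have h2'' : (D • V).a₂ ∈ maximalIdeal R ^ 1 := by rwa [pow_one]
  have h3' : (D • V).a₃ ∈ maximalIdeal R ^ 1 := by rwa [pow_one]
  refine ⟨D, OggBound.b₂_mem_pow _ (n₁ := 1) (n₂ := 1) h1' h2'',
    OggBound.b₄_mem_pow _ (n₁ := 1) (n₃ := 1) (n₄ := 2) h1' h3' h4, ?_⟩
  exact exists_eq_uniformizer_pow_mul_unit (OggBound.b₆_mem_pow _ (n₃ := 1) (n₆ := 2) h3' h6) hb₆

/-- **Type `IV*`, `2 ∈ R^×`: `b₂ ∈ 𝔪²`, `b₄ ∈ 𝔪³`, `b₆ = π⁴·(unit)`** (normal form of Step 8: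
`π ∣ a₁`, `π² ∣ a₂, a₃`, `π³ ∣ a₄`, `π⁴ ∣ a₆`, and `Y² + a₃,₂Y - a₆,₄` with distinct roots, i.e.
`a₃,₂² + 4a₆,₄ ≢ 0`). [cite: SilvermanATAEC1994, IV.9.4 Step 8] -/
theorem exists_smul_b_of_kodairaSymbolOfMinimal_eq_IVstar [PerfectField (ResidueField R)]
    (V : WeierstrassCurve R) (hV : V.kodairaSymbolOfMinimal = .IVstar) :
    ∃ D : WeierstrassCurve.VariableChange R,
      (D • V).b₂ ∈ maximalIdeal R ^ 2 ∧ (D • V).b₄ ∈ maximalIdeal R ^ 3 ∧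
      ∃ u : R, IsUnit u ∧ (D • V).b₆ = uniformizer R ^ 4 * u := by
  have hϖ : Irreducible (uniformizer R) := irreducible_uniformizer
  obtain ⟨D, h1, h2', h3, h4, h6, hq⟩ := exists_smul_of_kodairaSymbolOfMinimal_eq_IVstar V hV
  have h1' : (D • V).a₁ ∈ maximalIdeal R ^ 1 := by rwa [pow_one]
  refine ⟨D, OggBound.b₂_mem_pow _ (n₁ := 1) (n₂ := 2) h1' h2',
    OggBound.b₄_mem_pow _ (n₁ := 1) (n₃ := 2) (n₄ := 3) h1' h3 h4, ?_⟩
  obtain ⟨γ, hγ⟩ := (mem_maximalIdeal_pow_iff_dvd_of_irreducible hϖ _ _).mp h3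
  obtain ⟨r, hr⟩ := (mem_maximalIdeal_pow_iff_dvd_of_irreducible hϖ _ _).mp h6
  rw [quadraticStep8_eq hγ hr] at hq
  have hne := CharTwo.sq_add_four_mul_ne_zero_of_distinctRootCount_eq_two _ _ hq
  have hunit : IsUnit (γ ^ 2 + 4 * r) := by
    rw [isUnit_iff_residue_ne_zero]
    rwa [map_add, map_pow, map_mul, map_ofNat]
  refine ⟨γ ^ 2 + 4 * r, hunit, ?_⟩
  have eq : (D • V).b₆ = (D • V).a₃ * (D • V).a₃ + 4 * (D • V).a₆ := by
    rw [WeierstrassCurve.b₆]; ring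
  rw [eq, hγ, hr]; ring

/-- **Type `II*`, `2 ∈ R^×`: `b₂ ∈ 𝔪²`, `b₄ ∈ 𝔪⁴`, `b₆ = π⁵·(unit)`** (normal form of Step 10:
`π ∣ a₁`, `π² ∣ a₂`, `π³ ∣ a₃`, `π⁴ ∣ a₄`, `π⁵ ∣ a₆`, `π⁶ ∤ a₆`).
[cite: SilvermanATAEC1994, IV.9.4 Step 10] -/
theorem exists_smul_b_of_kodairaSymbolOfMinimal_eq_IIstar [PerfectField (ResidueField R)]
    (h2 : IsUnit (2 : R)) (V : WeierstrassCurve R) (hV : V.kodairaSymbolOfMinimal = .IIstar) :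
    ∃ D : WeierstrassCurve.VariableChange R,
      (D • V).b₂ ∈ maximalIdeal R ^ 2 ∧ (D • V).b₄ ∈ maximalIdeal R ^ 4 ∧
      ∃ u : R, IsUnit u ∧ (D • V).b₆ = uniformizer R ^ 5 * u := by
  obtain ⟨D, h1, h2', h3, h4, h6, h6'⟩ := exists_smul_of_kodairaSymbolOfMinimal_eq_IIstar V hV
  have h1' : (D • V).a₁ ∈ maximalIdeal R ^ 1 := by rwa [pow_one]
  refine ⟨D, OggBound.b₂_mem_pow _ (n₁ := 1) (n₂ := 2) h1' h2',
    OggBound.b₄_mem_pow _ (n₁ := 1) (n₃ := 3) (n₄ := 4) h1' h3 h4, ?_⟩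
  exact exists_b₆_eq_of_a₆ h2 _ (k := 5) (Ideal.mul_mem_mul h3 h3 |> fun h ↦ by
    rwa [← pow_add] at h) h6 h6'

end LocalIndex


end Literature.NumberTheory.EllipticCurves

/-! ## §2. Places of Dedekind domains: the shapes on a `K_v`-model, and `δ_v` -/

namespace WeierstrassCurve

open Literature.NumberTheory.EllipticCurves Literature.NumberTheory.DiophantineGeometry
  Literature.NumberTheory.DiophantineGeometry.TateAlgorithm IsDedekindDomain.HeightOneSpectrum

section Dedekind

variable {A : Type*} [CommRing A] [IsDedekindDomain A] {K' : Type*} [Field K'] [Algebra A K']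
  [IsFractionRing A K'] (v : HeightOneSpectrum A) (X : WeierstrassCurve K')

/-- **Transfer from the local minimal model to a `K_v`-model.**  If some `𝒪_v`-change of
variables of the integral local minimal model `M` at `v` has `b₂ ∈ 𝔪^{k₂}`, `b₄ ∈ 𝔪^{k₄}`,
`b₆ = ϖ^{k₆}·(unit)` (`ϖ` the chosen uniformiser of `𝒪_v`), then for any `π ∈ K` with
`ord_v(π) = 1` there is a `K_v`-model `C • X` with `b₂ = π^{k₂}β₂`, `b₄ = π^{k₄}β₄`,
`b₆ = π^{k₆}β₆`, `Δ = π^{ord_v(Δ_min)}δ`, `βᵢ ∈ 𝒪_v`, `β₆, δ ∈ 𝒪_v^×` (the change of variables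
is integral, so `ord Δ` is still `ord_v(Δ_min)`). [folklore] -/
theorem exists_variableChange_b_of_exists_smul_localMinimalIntegralModel [X.IsElliptic]
    {k₂ k₄ k₆ : ℕ}
    (hD : ∃ D : VariableChange (v.adicCompletionIntegers K'),
      (D • X.localMinimalIntegralModel v).b₂ ∈ maximalIdeal (v.adicCompletionIntegers K') ^ k₂ ∧
      (D • X.localMinimalIntegralModel v).b₄ ∈ maximalIdeal (v.adicCompletionIntegers K') ^ k₄ ∧
      ∃ u : v.adicCompletionIntegers K', IsUnit u ∧
        (D • X.localMinimalIntegralModel v).b₆ = uniformizer (v.adicCompletionIntegers K') ^ k₆ * u)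
    {π : K'} (hπ : v.valuation K' π = WithZero.exp (-1 : ℤ)) :
    ∃ (C : VariableChange (v.adicCompletion K')) (β₂ β₄ β₆ δ : v.adicCompletionIntegers K'),
      IsUnit β₆ ∧ IsUnit δ ∧
      (C • X.baseChange (v.adicCompletion K')).b₂ = (π : v.adicCompletion K') ^ k₂ * β₂ ∧
      (C • X.baseChange (v.adicCompletion K')).b₄ = (π : v.adicCompletion K') ^ k₄ * β₄ ∧
      (C • X.baseChange (v.adicCompletion K')).b₆ = (π : v.adicCompletion K') ^ k₆ * β₆ ∧
      (C • X.baseChange (v.adicCompletion K')).Δ =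
        (π : v.adicCompletion K') ^ X.ordMinimalDiscriminant v * δ := by
  set O := v.adicCompletionIntegers K' with hO
  have hπv : Valued.v (π : v.adicCompletion K') = WithZero.exp (-1 : ℤ) := by
    rw [valuedAdicCompletion_eq_valuation', hπ]
  set ϖ : O := ⟨(π : v.adicCompletion K'), by
    rw [mem_adicCompletionIntegers, hπv, ← WithZero.exp_zero, WithZero.exp_le_exp]; norm_num⟩
    with hϖdef
  have hϖ : Irreducible ϖ := irreducible_adicCompletionIntegers_of_valued_eq v ϖ hπv
  set M := X.localMinimalIntegralModel v with hM
  have hΔM0 : M.Δ ≠ 0 := localMinimalIntegralModel_Δ_ne_zero v X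
  obtain ⟨D, hb₂, hb₄, u, hu, hb₆⟩ := hD
  set N := D • M with hN
  obtain ⟨β₂, hβ₂⟩ := (mem_maximalIdeal_pow_iff_dvd_of_irreducible hϖ _ _).mp hb₂
  obtain ⟨β₄, hβ₄⟩ := (mem_maximalIdeal_pow_iff_dvd_of_irreducible hϖ _ _).mp hb₄
  -- `uniformizer O = ϖ μ⁻¹`
  obtain ⟨μ, hμ⟩ := associated_of_irreducible O irreducible_uniformizer hϖ
  have hunif : uniformizer O = ϖ * ↑μ⁻¹ := by rw [← hμ, mul_assoc, Units.mul_inv, mul_one]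
  have hb₆' : N.b₆ = ϖ ^ k₆ * (↑μ⁻¹ ^ k₆ * u) := by rw [hb₆, hunif]; ring
  -- `Δ(M) = ϖ^{ord Δ_min} u₀`
  obtain ⟨n, u₀, hMu⟩ := IsDiscreteValuationRing.eq_unit_mul_pow_irreducible hΔM0 hϖ
  have hn : n = X.ordMinimalDiscriminant v := by
    have h := IsDiscreteValuationRing.addVal_def M.Δ u₀ hϖ n hMu
    rw [ordMinimalDiscriminant, ← hM, h]
    simp
  have hΔN : N.Δ = ϖ ^ n * (↑D.u⁻¹ ^ 12 * ↑u₀) := by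
    rw [hN, variableChange_Δ, hMu]; ring
  have hδ : IsUnit ((↑D.u⁻¹ ^ 12 * ↑u₀ : O)) := ((Units.isUnit _).pow 12).mul (Units.isUnit _)
  obtain ⟨C₀, hC₀⟩ : ∃ C₀ : VariableChange (v.adicCompletion K'),
      C₀ • X.baseChange (v.adicCompletion K') = X.localMinimalModel v := ⟨_, rfl⟩
  have hMK : M.map (algebraMap O (v.adicCompletion K')) = X.localMinimalModel v := by
    rw [hM, localMinimalIntegralModel]
    exact baseChange_integralModel_eq O (X.localMinimalModel v)
  have hNK : N.map (algebraMap O (v.adicCompletion K')) =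
      (D.map (algebraMap O (v.adicCompletion K')) * C₀) • X.baseChange (v.adicCompletion K') := by
    rw [mul_smul, hC₀, ← hMK, hN, map_variableChange]
  have hβ₆u : IsUnit ((↑μ⁻¹ : O) ^ k₆ * u) := ((Units.isUnit _).pow k₆).mul hu
  refine ⟨D.map (algebraMap O (v.adicCompletion K')) * C₀, β₂, β₄, (↑μ⁻¹ : O) ^ k₆ * u,
    (↑D.u⁻¹ : O) ^ 12 * ↑u₀, hβ₆u, hδ, ?_, ?_, ?_, ?_⟩
  · rw [← hNK, map_b₂, hβ₂, map_mul, map_pow]; rfl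
  · rw [← hNK, map_b₄, hβ₄, map_mul, map_pow]; rfl
  · rw [← hNK, map_b₆, hb₆', map_mul, map_pow]; rfl
  · rw [← hNK, map_Δ, hΔN, map_mul, map_pow, ← hn]; rfl

/-- **The wild types at `v ∤ 2`: shapes of `b₂, b₄, b₆, Δ` on a `K_v`-model.**  For an elliptic
curve `X` over the fraction field of a Dedekind domain, a place `v ∤ 2` (perfect residue field)
of Kodaira type `II`, `IV`, `IV*` or `II*`, and `π` with `ord_v(π) = 1`, there is a `K_v`-model
`C • X` with `b₂ = π^{k₂}β₂`, `b₄ = π^{k₄}β₄`, `b₆ = π^{k₆}β₆` (`β₆ ∈ 𝒪_v^×`),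
`Δ = π^{ord_v Δ_min}δ` (`δ ∈ 𝒪_v^×`), where `(k₂, k₄, k₆) = (1,1,1), (1,2,2), (2,3,4), (2,4,5)`
respectively — so its `2`-division cubic `x³ + (b₂/4)x² + (b₄/2)x + b₆/4` has
`ord A₆ = k₆`, `3·ord A₂ ≥ k₆`, `3·ord A₄ ≥ 2k₆` (*ATAEC* p. 369).
[cite: SilvermanATAEC1994, IV.9.4 Steps 3, 5, 8, 10 and proof of IV.11.1, p = 3 (PDF pp. 368–371)] -/
theorem exists_variableChange_b_of_kodairaSymbolAt_wild [X.IsElliptic]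
    [PerfectField (IsLocalRing.ResidueField (v.adicCompletionIntegers K'))]
    (h2 : ringChar (A ⧸ v.asIdeal) ≠ 2) {k₂ k₄ k₆ : ℕ}
    (hT : (X.kodairaSymbolAt v = .II ∧ k₂ = 1 ∧ k₄ = 1 ∧ k₆ = 1) ∨
      (X.kodairaSymbolAt v = .IV ∧ k₂ = 1 ∧ k₄ = 2 ∧ k₆ = 2) ∨
      (X.kodairaSymbolAt v = .IVstar ∧ k₂ = 2 ∧ k₄ = 3 ∧ k₆ = 4) ∨
      (X.kodairaSymbolAt v = .IIstar ∧ k₂ = 2 ∧ k₄ = 4 ∧ k₆ = 5))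
    {π : K'} (hπ : v.valuation K' π = WithZero.exp (-1 : ℤ)) :
    ∃ (C : VariableChange (v.adicCompletion K')) (β₂ β₄ β₆ δ : v.adicCompletionIntegers K'),
      IsUnit β₆ ∧ IsUnit δ ∧
      (C • X.baseChange (v.adicCompletion K')).b₂ = (π : v.adicCompletion K') ^ k₂ * β₂ ∧
      (C • X.baseChange (v.adicCompletion K')).b₄ = (π : v.adicCompletion K') ^ k₄ * β₄ ∧
      (C • X.baseChange (v.adicCompletion K')).b₆ = (π : v.adicCompletion K') ^ k₆ * β₆ ∧
      (C • X.baseChange (v.adicCompletion K')).Δ =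
        (π : v.adicCompletion K') ^ X.ordMinimalDiscriminant v * δ := by
  have hu2 : IsUnit (2 : v.adicCompletionIntegers K') :=
    HeightOneSpectrum.isUnit_two_adicCompletionIntegers K' v h2
  refine X.exists_variableChange_b_of_exists_smul_localMinimalIntegralModel v ?_ hπ
  rw [kodairaSymbolAt_def] at hT
  rcases hT with ⟨hT, rfl, rfl, rfl⟩ | ⟨hT, rfl, rfl, rfl⟩ | ⟨hT, rfl, rfl, rfl⟩ |
    ⟨hT, rfl, rfl, rfl⟩
  · exact LocalIndex.exists_smul_b_of_kodairaSymbolOfMinimal_eq_II hu2 _ hT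
  · exact LocalIndex.exists_smul_b_of_kodairaSymbolOfMinimal_eq_IV _ hT
  · exact LocalIndex.exists_smul_b_of_kodairaSymbolOfMinimal_eq_IVstar _ hT
  · exact LocalIndex.exists_smul_b_of_kodairaSymbolOfMinimal_eq_IIstar hu2 _ hT

/-- **`δ_v = ord_v(Δ_min) - (m_v + 1)` at the wild types**: `f_v = ord_v(Δ_min) + 1 - m_v` (the
definition of `conductorExponent` by Ogg's formula) and `ε_v = 2`, with `m_v = 1, 3, 7, 9` for
`II, IV, IV*, II*`; so `δ_v = ord_v(Δ_min) - 2, - 4, - 8, - 10` (*ATAEC* pp. 368, 371: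
"`v_K(𝔇_{E/K}) = 2 + δ(E/K)`" for `II, II*` up to the `12` of `II*`, "`= 4 + δ(E/K)`" for
`IV, IV*`).  Natural-number subtraction; no hypothesis on `v`. [cite: SilvermanATAEC1994, proof of IV.11.1, p = 3 (PDF pp. 368–371)] -/
theorem wildConductorExponent_eq_of_kodairaSymbolAt_wild {m : ℕ}
    (hT : (X.kodairaSymbolAt v = .II ∧ m = 1) ∨ (X.kodairaSymbolAt v = .IV ∧ m = 3) ∨
      (X.kodairaSymbolAt v = .IVstar ∧ m = 7) ∨ (X.kodairaSymbolAt v = .IIstar ∧ m = 9)) :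
    X.wildConductorExponent v = X.ordMinimalDiscriminant v - (m + 1) := by
  unfold wildConductorExponent conductorExponent numComponentsAt
  rcases hT with ⟨h, rfl⟩ | ⟨h, rfl⟩ | ⟨h, rfl⟩ | ⟨h, rfl⟩ <;> rw [h] <;>
    simp only [KodairaSymbol.numComponents, KodairaSymbol.tameConductorExponent] <;> omega

end Dedekind

end WeierstrassCurve

end
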